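import Mathlib
import Literature.Barriers.PneNP.TSPExtensionComplexity
import Literature.Barriers.PneNP.TSPExtensionComplexityFaces
import Literature.Barriers.PneNP.ExtendedFormulationLinearImage
import HarnessLib

/-!
# Calculus of extended formulations: Minkowski sum and convex hull of a union
# (Hrubeš–Yehudayoff 2021, Lemma 34; Balas)

Topic `Literature/Barriers/PneNP` (where `ExtendedFormulation` / `HasEFOfSize` live, file
`TSPExtensionComplexity.lean`). Source: P. Hrubeš, A. Yehudayoff, *Shadows of Newton polytopes*, CCC 2021,
§5.4 (held text `paper:url-d136d073b26d` p0014 L26–27): "▶ Lemma 34. For polytopes `P, Q ⊆ ℝⁿ` we have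
`xc(P + Q) ≤ xc(P) + xc(Q)` and `xc(P ⊔ Q) ≤ xc(P) + xc(Q) + 2`." (`P ⊔ Q` = the convex hull of `P ∪ Q`; the
second bound is Balas' extended formulation of a disjunction.)  This is the engine of HY21 Theorem 35
(`Literature.Computability.AlgebraicComplexity.HrubesYehudayoff.theorem35`: monotone formulas have Newton polytopes
of linear extension complexity), whose proof is "a straightforward induction" over these two bounds.

What is proved here, over the tree's slack-form vocabulary (`HasEFOfSize P r`: `P = {x | ∃ y ∈ ℝ^r, y ≥ 0,
E x + F y = g}`, all extra variables sign-constrained).  Since that format has no free extra variables, the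
induction is run on the sub-class of POINTED (affine V-type) formulations `P = {c + A y | y ≥ 0, B y = b}`
satisfying the recession condition `y ≥ 0 ∧ B y = 0 ⇒ A y = 0` (`HasPointedEFOfSize`; every such formulation is a
slack-form EF of the same size, `HasPointedEFOfSize.hasEFOfSize`).  On this class: a point costs `0`
(`hasPointedEFOfSize_singleton`), the convex hull of a finite set `S` costs `#S` (`hasPointedEFOfSize_convexHull_finset`),
the Minkowski sum costs `r₁ + r₂` (`HasPointedEFOfSize.add`) and the convex hull of a union costs `r₁ + r₂ + 2`
(`HasPointedEFOfSize.convexHull_union`, Balas: variables `(y₁, y₂, λ, μ) ≥ 0`, equations `B₁ y₁ = λ b₁`,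
`B₂ y₂ = μ b₂`, `λ + μ = 1`, point `λ c₁ + A₁ y₁ + μ c₂ + A₂ y₂`; the recession condition is exactly what makes the
degenerate branch `λ = 0` land in `Q`).  Every polytope built from points by these two operations — in particular
the Newton polytope of a monotone formula — is pointed, so this is Lemma 34 in the form Theorem 35 consumes; the
bridge from an arbitrary slack-form EF of a bounded set to a pointed one (elimination of the natural variables) is
not needed for that — it is formalised in the appended last section (2026-08-29: `HasEFOfSize.hasPointedEFOfSize`,
whence `HasEFOfSize.convexHull_union`: `xc(P ⊔ Q) ≤ xc(P) + xc(Q) + 2` for ALL bounded `P, Q`, and the finite-union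
forms `HasPointedEFOfSize.convexHull_biUnion` / `HasEFOfSize.convexHull_biUnion`).  All statements are theorems
(no named facts).  Honest framing:
Literature infrastructure; nothing here bears on `VP ≠ VNP` (NOT proved). [cite: HrubesYehudayoff2021, Lemma 34]
-/

noncomputable section

namespace Literature.Barriers.PneNP

open Matrix
open scoped Pointwise

variable {ι : Type}

/-! ### Pointed (affine V-type) formulations -/

/-- The set `{c + A y | y ≥ 0, B y = b} ⊆ ℝ^ι` cut out by affine V-type data `(c, A, B, b)`: the natural
variables are an explicit affine image of sign-constrained extra variables `y`, which are subject to
equations only. [cite: HrubesYehudayoff2021, Lemma 34] -/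
def pointedSet {α κ : Type*} [Fintype α] (c : ι → ℝ) (A : Matrix ι α ℝ) (B : Matrix κ α ℝ)
    (b : κ → ℝ) : Set (ι → ℝ) :=
  {x | ∃ y : α → ℝ, (∀ j, 0 ≤ y j) ∧ B *ᵥ y = b ∧ x = c + A *ᵥ y}

/-- **`P` has a pointed extended formulation of size `r`**: `P = {c + A y | y ∈ ℝ^r, y ≥ 0, B y = b}` for
finitely many equations, with the RECESSION CONDITION `y ≥ 0 ∧ B y = 0 ⇒ A y = 0` (every direction of the
lifted polyhedron projects to `0`).  The extra variables are indexed by an arbitrary finite type of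
cardinality `r`.  Implies `HasEFOfSize P r` (`HasPointedEFOfSize.hasEFOfSize`); closed under Minkowski sum at
cost `r₁ + r₂` and under convex hull of a union at cost `r₁ + r₂ + 2` (HY21 Lemma 34).
[cite: HrubesYehudayoff2021, Lemma 34] -/
def HasPointedEFOfSize (P : Set (ι → ℝ)) (r : ℕ) : Prop :=
  ∃ (α κ : Type) (_ : Fintype α) (_ : Fintype κ) (c : ι → ℝ) (A : Matrix ι α ℝ) (B : Matrix κ α ℝ)
    (b : κ → ℝ), Fintype.card α = r ∧ (∀ y : α → ℝ, (∀ j, 0 ≤ y j) → B *ᵥ y = 0 → A *ᵥ y = 0) ∧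
      P = pointedSet c A B b

/-- Componentwise reading of an equation between `Sum.elim`-vectors. [folklore] -/
private theorem sumElim_eq_sumElim_iff {α β : Type*} (u u' : α → ℝ) (v v' : β → ℝ) :
    Sum.elim u v = Sum.elim u' v' ↔ u = u' ∧ v = v' := by
  constructor
  · intro h
    exact ⟨funext fun a => by simpa using congrFun h (Sum.inl a),
      funext fun b => by simpa using congrFun h (Sum.inr b)⟩
  · rintro ⟨rfl, rfl⟩
    rfl

/-- The zero vector on a sum type is `Sum.elim 0 0`. [folklore] -/
private theorem zero_eq_sumElim_zero {α β : Type*} : (0 : α ⊕ β → ℝ) = Sum.elim (0 : α → ℝ) (0 : β → ℝ) := by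
  funext s
  rcases s with a | b <;> rfl

/-- A pointed set is convex (it is the affine image of a polyhedron) — the convexity half of Balas' union
bound. [cite: HrubesYehudayoff2021, Lemma 34] -/
theorem convex_pointedSet {α κ : Type*} [Fintype α] (c : ι → ℝ) (A : Matrix ι α ℝ)
    (B : Matrix κ α ℝ) (b : κ → ℝ) : Convex ℝ (pointedSet c A B b) := by
  rintro x ⟨y, hy, hBy, rfl⟩ x' ⟨y', hy', hBy', rfl⟩ a a' ha ha' hsum
  refine ⟨a • y + a' • y', fun j => ?_, ?_, ?_⟩
  · simp only [Pi.add_apply, Pi.smul_apply, smul_eq_mul]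
    exact add_nonneg (mul_nonneg ha (hy j)) (mul_nonneg ha' (hy' j))
  · rw [mulVec_add, mulVec_smul, mulVec_smul, hBy, hBy', ← add_smul, hsum, one_smul]
  · rw [mulVec_add, mulVec_smul, mulVec_smul]
    have ha'eq : a' = 1 - a := by linarith
    subst ha'eq
    funext i
    simp only [Pi.add_apply, Pi.smul_apply, smul_eq_mul]
    ring

/-- **Pointed formulations are slack-form EFs of the same size**: `{c + A y | y ≥ 0, B y = b}` is the
projection of the slack-form system `x - A y = c`, `B y = b`, `y ≥ 0` with `|α| = r` sign-constrained
variables (`hasEFOfSize_of_system` re-indexes rows and variables by `Fin`), so every bound below is a bound on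
the slack-form size `xc` of HY21 §5.4. [cite: HrubesYehudayoff2021, Lemma 34] -/
theorem HasPointedEFOfSize.hasEFOfSize [Fintype ι] {P : Set (ι → ℝ)} {r : ℕ}
    (h : HasPointedEFOfSize P r) : HasEFOfSize P r := by
  classical
  obtain ⟨α, κ, _, _, c, A, B, b, hcard, -, rfl⟩ := h
  have h0 := hasEFOfSize_of_system (ι := ι) (fromRows (1 : Matrix ι ι ℝ) (0 : Matrix κ ι ℝ))
    (fromRows (-A) B) (Sum.elim c b)
  rw [hcard] at h0
  convert h0 using 1
  ext x
  simp only [pointedSet, Set.mem_setOf_eq, fromRows_mulVec, one_mulVec, zero_mulVec, neg_mulVec,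
    sumElim_add_sumElim_eq_sumElim_iff, zero_add]
  constructor
  · rintro ⟨y, hy, hB, rfl⟩
    exact ⟨y, hy, by abel, hB⟩
  · rintro ⟨y, hy, hx, hB⟩
    exact ⟨y, hy, hB, by rw [← hx]; abel⟩

/-! ### Points and finite convex hulls -/

/-- A point has a pointed formulation of size `0` (`xc` of a point is `0`: the base case of the induction
behind HY21 Theorem 35). [cite: HrubesYehudayoff2021, Lemma 34] -/
theorem hasPointedEFOfSize_singleton (p : ι → ℝ) : HasPointedEFOfSize ({p} : Set (ι → ℝ)) 0 := by
  refine ⟨Fin 0, Fin 0, inferInstance, inferInstance, p, 0, 0, 0, by simp, fun y _ _ => by simp, ?_⟩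
  ext x
  simp only [pointedSet, Set.mem_singleton_iff, Set.mem_setOf_eq]
  constructor
  · rintro rfl
    exact ⟨0, fun _ => le_rfl, by simp, by simp⟩
  · rintro ⟨_, -, -, rfl⟩
    simp

/-- **The convex hull of a finite set `S` has a pointed formulation of size `#S`** (its V-representation
`x = Σ_s λ_s s`, `Σ_s λ_s = 1`, `λ ≥ 0`; recession: `λ ≥ 0 ∧ Σ λ_s = 0 ⇒ λ = 0`), so `xc(conv S) ≤ #S` for
every polytope. [cite: HrubesYehudayoff2021, Lemma 34] -/
theorem hasPointedEFOfSize_convexHull_finset (S : Finset (ι → ℝ)) :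
    HasPointedEFOfSize (convexHull ℝ (S : Set (ι → ℝ))) S.card := by
  classical
  refine ⟨S, Unit, inferInstance, inferInstance, 0,
    Matrix.of fun i (s : S) => (s : ι → ℝ) i, Matrix.of fun _ _ => 1, fun _ => 1,
    by simp, ?_, ?_⟩
  · intro y hy hB
    have hsum : ∑ s, y s = 0 := by
      have := congrFun hB ()
      simpa [mulVec, dotProduct] using this
    have hy0 : ∀ s, y s = 0 := fun s =>
      (Finset.sum_eq_zero_iff_of_nonneg fun s _ => hy s).1 hsum s (Finset.mem_univ s)
    funext i
    simp [mulVec, dotProduct, hy0]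
  · ext x
    simp only [pointedSet, Set.mem_setOf_eq, zero_add]
    rw [Finset.convexHull_eq, Set.mem_setOf_eq]
    constructor
    · rintro ⟨w, hw0, hw1, hcm⟩
      refine ⟨fun s => w s, fun s => hw0 _ s.2, ?_, ?_⟩
      · funext u
        simp only [mulVec, dotProduct, Matrix.of_apply, one_mul]
        rw [Finset.sum_coe_sort S w, hw1]
      · rw [← hcm, Finset.centerMass_eq_of_sum_1 _ _ hw1]
        funext i
        simp only [mulVec, dotProduct, Matrix.of_apply, Finset.sum_apply, Pi.smul_apply, smul_eq_mul]
        rw [← Finset.sum_coe_sort S]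
        exact Finset.sum_congr rfl fun s _ => mul_comm _ _
    · rintro ⟨y, hy, hB, rfl⟩
      have hsum : ∑ s : S, y s = 1 := by
        have := congrFun hB ()
        simpa [mulVec, dotProduct] using this
      refine ⟨fun s => if hs : s ∈ S then y ⟨s, hs⟩ else 0, fun s hs => by simp [hs, hy], ?_, ?_⟩
      · rw [← hsum, ← Finset.sum_coe_sort S]
        exact Finset.sum_congr rfl fun s _ => by simp
      · have hsum' : ∑ s ∈ S, (fun s => if hs : s ∈ S then y ⟨s, hs⟩ else 0) s = 1 := by
          rw [← hsum, ← Finset.sum_coe_sort S]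
          exact Finset.sum_congr rfl fun s _ => by simp
        rw [Finset.centerMass_eq_of_sum_1 _ _ hsum']
        funext i
        simp only [mulVec, dotProduct, Matrix.of_apply, Finset.sum_apply, Pi.smul_apply, smul_eq_mul]
        rw [← Finset.sum_coe_sort S]
        exact Finset.sum_congr rfl fun s _ => by simp [mul_comm]

/-! ### Minkowski sum: `xc(P + Q) ≤ xc(P) + xc(Q)` -/

/-- **HY21 Lemma 34, first half (pointed form): the Minkowski sum of pointed formulations of sizes `r₁, r₂`
has one of size `r₁ + r₂`** — variables `(y₁, y₂)`, equations `B₁ y₁ = b₁`, `B₂ y₂ = b₂`, point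
`(c₁ + c₂) + A₁ y₁ + A₂ y₂`. [cite: HrubesYehudayoff2021, Lemma 34] -/
theorem HasPointedEFOfSize.add {P Q : Set (ι → ℝ)} {r₁ r₂ : ℕ} (hP : HasPointedEFOfSize P r₁)
    (hQ : HasPointedEFOfSize Q r₂) : HasPointedEFOfSize (P + Q) (r₁ + r₂) := by
  obtain ⟨α₁, κ₁, _, _, c₁, A₁, B₁, b₁, hc₁, hrec₁, rfl⟩ := hP
  obtain ⟨α₂, κ₂, _, _, c₂, A₂, B₂, b₂, hc₂, hrec₂, rfl⟩ := hQ
  refine ⟨α₁ ⊕ α₂, κ₁ ⊕ κ₂, inferInstance, inferInstance, c₁ + c₂, fromCols A₁ A₂,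
    fromBlocks B₁ 0 0 B₂, Sum.elim b₁ b₂, by simp [hc₁, hc₂], ?_, ?_⟩
  · intro y hy hB
    rw [fromBlocks_mulVec, zero_mulVec, zero_mulVec, add_zero, zero_add, zero_eq_sumElim_zero,
      sumElim_eq_sumElim_iff] at hB
    rw [fromCols_mulVec, hrec₁ (y ∘ Sum.inl) (fun j => hy _) hB.1, hrec₂ (y ∘ Sum.inr) (fun j => hy _) hB.2,
      add_zero]
  · ext x
    simp only [pointedSet, Set.mem_add, Set.mem_setOf_eq]
    constructor
    · rintro ⟨p, ⟨y₁, hy₁, hB₁, rfl⟩, q, ⟨y₂, hy₂, hB₂, rfl⟩, rfl⟩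
      refine ⟨Sum.elim y₁ y₂, ?_, ?_, ?_⟩
      · rintro (j | j)
        · exact hy₁ j
        · exact hy₂ j
      · rw [fromBlocks_mulVec, zero_mulVec, zero_mulVec, add_zero, zero_add, Sum.elim_comp_inl,
          Sum.elim_comp_inr, hB₁, hB₂]
      · rw [fromCols_mulVec_sumElim]
        abel
    · rintro ⟨y, hy, hB, rfl⟩
      rw [fromBlocks_mulVec, zero_mulVec, zero_mulVec, add_zero, zero_add, sumElim_eq_sumElim_iff] at hB
      refine ⟨c₁ + A₁ *ᵥ (y ∘ Sum.inl), ⟨_, fun j => hy _, hB.1, rfl⟩, c₂ + A₂ *ᵥ (y ∘ Sum.inr),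
        ⟨_, fun j => hy _, hB.2, rfl⟩, ?_⟩
      rw [fromCols_mulVec]
      abel

/-- Corollary in slack form: `xc(P + Q) ≤ r₁ + r₂` for pointedly represented `P, Q`.
[cite: HrubesYehudayoff2021, Lemma 34] -/
theorem HasPointedEFOfSize.hasEFOfSize_add [Fintype ι] {P Q : Set (ι → ℝ)} {r₁ r₂ : ℕ}
    (hP : HasPointedEFOfSize P r₁) (hQ : HasPointedEFOfSize Q r₂) : HasEFOfSize (P + Q) (r₁ + r₂) :=
  (hP.add hQ).hasEFOfSize

/-! ### Convex hull of a union (Balas): `xc(P ⊔ Q) ≤ xc(P) + xc(Q) + 2` -/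

section UnionData

variable {α₁ α₂ κ₁ κ₂ : Type} [Fintype α₁] [Fintype α₂]

/-- A vector as a one-column matrix (column index `Unit`). [folklore] -/
def colVec {κ : Type*} (v : κ → ℝ) : Matrix κ Unit ℝ :=
  Matrix.of fun l _ => v l

/-- `colVec v` acts on the single variable `w ()` by `w () • v`. [folklore] -/
private theorem colVec_mulVec {κ : Type*} (v : κ → ℝ) (w : Unit → ℝ) : colVec v *ᵥ w = w () • v := by
  funext l
  simp [colVec, mulVec, dotProduct, mul_comm]

/-- Natural-variable block of Balas' union formulation: `x = A₁ y₁ + A₂ y₂ + λ c₁ + μ c₂` in the variables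
`((y₁, y₂), (λ, μ))`. [cite: HrubesYehudayoff2021, Lemma 34] -/
def unionA (c₁ c₂ : ι → ℝ) (A₁ : Matrix ι α₁ ℝ) (A₂ : Matrix ι α₂ ℝ) :
    Matrix ι ((α₁ ⊕ α₂) ⊕ (Unit ⊕ Unit)) ℝ :=
  fromCols (fromCols A₁ A₂) (fromCols (colVec c₁) (colVec c₂))

/-- Equation block of Balas' union formulation: rows `B₁ y₁ - λ b₁`, `B₂ y₂ - μ b₂`, `λ + μ`.
[cite: HrubesYehudayoff2021, Lemma 34] -/
def unionB (B₁ : Matrix κ₁ α₁ ℝ) (B₂ : Matrix κ₂ α₂ ℝ) (b₁ : κ₁ → ℝ) (b₂ : κ₂ → ℝ) :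
    Matrix ((κ₁ ⊕ κ₂) ⊕ Unit) ((α₁ ⊕ α₂) ⊕ (Unit ⊕ Unit)) ℝ :=
  fromBlocks (fromBlocks B₁ 0 0 B₂) (fromBlocks (colVec (-b₁)) 0 0 (colVec (-b₂))) 0
    (Matrix.of fun _ _ => 1)

/-- The point of the union formulation at variables `((y₁, y₂), (λ, μ))`. [cite: HrubesYehudayoff2021, Lemma 34] -/
theorem unionA_mulVec (c₁ c₂ : ι → ℝ) (A₁ : Matrix ι α₁ ℝ) (A₂ : Matrix ι α₂ ℝ) (y₁ : α₁ → ℝ)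
    (y₂ : α₂ → ℝ) (l m : Unit → ℝ) :
    unionA c₁ c₂ A₁ A₂ *ᵥ Sum.elim (Sum.elim y₁ y₂) (Sum.elim l m) =
      A₁ *ᵥ y₁ + A₂ *ᵥ y₂ + (l () • c₁ + m () • c₂) := by
  simp only [unionA, fromCols_mulVec_sumElim, colVec_mulVec]

/-- The equations of the union formulation at variables `((y₁, y₂), (λ, μ))` with right-hand side
`(0, 0, t)` read: `B₁ y₁ = λ b₁`, `B₂ y₂ = μ b₂`, `λ + μ = t`. [cite: HrubesYehudayoff2021, Lemma 34] -/
theorem unionB_mulVec_eq_iff (B₁ : Matrix κ₁ α₁ ℝ) (B₂ : Matrix κ₂ α₂ ℝ) (b₁ : κ₁ → ℝ) (b₂ : κ₂ → ℝ)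
    (y₁ : α₁ → ℝ) (y₂ : α₂ → ℝ) (l m : Unit → ℝ) (t : ℝ) :
    unionB B₁ B₂ b₁ b₂ *ᵥ Sum.elim (Sum.elim y₁ y₂) (Sum.elim l m) =
        Sum.elim (0 : κ₁ ⊕ κ₂ → ℝ) (fun _ => t) ↔
      B₁ *ᵥ y₁ = l () • b₁ ∧ B₂ *ᵥ y₂ = m () • b₂ ∧ l () + m () = t := by
  have hone : (Matrix.of fun (_ : Unit) (_ : Unit ⊕ Unit) => (1 : ℝ)) *ᵥ Sum.elim l m =
      fun _ => l () + m () := by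
    funext u
    simp [mulVec, dotProduct, Fintype.sum_sum_type]
  simp only [unionB, fromBlocks_mulVec, Sum.elim_comp_inl, Sum.elim_comp_inr, zero_mulVec,
    colVec_mulVec, add_zero, zero_add, hone]
  rw [sumElim_eq_sumElim_iff, zero_eq_sumElim_zero, sumElim_add_sumElim_eq_sumElim_iff]
  have h1 : B₁ *ᵥ y₁ + l () • -b₁ = 0 ↔ B₁ *ᵥ y₁ = l () • b₁ := by
    rw [smul_neg, ← sub_eq_add_neg, sub_eq_zero]
  have h2 : B₂ *ᵥ y₂ + m () • -b₂ = 0 ↔ B₂ *ᵥ y₂ = m () • b₂ := by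
    rw [smul_neg, ← sub_eq_add_neg, sub_eq_zero]
  have h3 : ((fun _ : Unit => l () + m ()) = fun _ => t) ↔ l () + m () = t :=
    ⟨fun h => congrFun h (), fun h => funext fun _ => h⟩
  rw [h1, h2, h3, and_assoc]

omit [Fintype α₁] [Fintype α₂] in
/-- Every variable vector of the union formulation splits as `((y₁, y₂), (λ, μ))`. [folklore] -/
private theorem exists_eq_sumElim_sumElim (y : (α₁ ⊕ α₂) ⊕ (Unit ⊕ Unit) → ℝ) :
    ∃ (y₁ : α₁ → ℝ) (y₂ : α₂ → ℝ) (l m : Unit → ℝ), y = Sum.elim (Sum.elim y₁ y₂) (Sum.elim l m) :=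
  ⟨fun j => y (Sum.inl (Sum.inl j)), fun j => y (Sum.inl (Sum.inr j)), fun u => y (Sum.inr (Sum.inl u)),
    fun u => y (Sum.inr (Sum.inr u)), by
      funext s
      rcases s with (j | j) | (u | u) <;> rfl⟩

end UnionData

/-- **HY21 Lemma 34, second half (Balas; pointed form): the convex hull of the union of pointed
formulations of sizes `r₁, r₂` has one of size `r₁ + r₂ + 2`** — variables `(y₁, y₂, λ, μ) ≥ 0`, equations
`B₁ y₁ = λ b₁`, `B₂ y₂ = μ b₂`, `λ + μ = 1`, point `λ c₁ + A₁ y₁ + μ c₂ + A₂ y₂`.  For `λ, μ > 0` the point is the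
convex combination `λ p + μ q` of `p = c₁ + A₁ (y₁/λ) ∈ P`, `q = c₂ + A₂ (y₂/μ) ∈ Q`; for `λ = 0` the recession
condition gives `A₁ y₁ = 0` and the point lies in `Q`. [cite: HrubesYehudayoff2021, Lemma 34] -/
theorem HasPointedEFOfSize.convexHull_union {P Q : Set (ι → ℝ)} {r₁ r₂ : ℕ}
    (hP : HasPointedEFOfSize P r₁) (hQ : HasPointedEFOfSize Q r₂) :
    HasPointedEFOfSize (convexHull ℝ (P ∪ Q)) (r₁ + r₂ + 2) := by
  obtain ⟨α₁, κ₁, _, _, c₁, A₁, B₁, b₁, hc₁, hrec₁, rfl⟩ := hP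
  obtain ⟨α₂, κ₂, _, _, c₂, A₂, B₂, b₂, hc₂, hrec₂, rfl⟩ := hQ
  refine ⟨(α₁ ⊕ α₂) ⊕ (Unit ⊕ Unit), (κ₁ ⊕ κ₂) ⊕ Unit, inferInstance, inferInstance, 0,
    unionA c₁ c₂ A₁ A₂, unionB B₁ B₂ b₁ b₂, Sum.elim (0 : κ₁ ⊕ κ₂ → ℝ) (fun _ => (1 : ℝ)),
    by simp [hc₁, hc₂], ?_, ?_⟩
  · -- recession condition
    intro y hy hB
    obtain ⟨y₁, y₂, l, m, rfl⟩ := exists_eq_sumElim_sumElim y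
    have h0 : (0 : (κ₁ ⊕ κ₂) ⊕ Unit → ℝ) = Sum.elim (0 : κ₁ ⊕ κ₂ → ℝ) (fun _ => (0 : ℝ)) := by
      funext s
      rcases s with s | s <;> rfl
    rw [h0, unionB_mulVec_eq_iff] at hB
    obtain ⟨h1, h2, h3⟩ := hB
    have hl0 : 0 ≤ l () := hy (Sum.inr (Sum.inl ()))
    have hm0 : 0 ≤ m () := hy (Sum.inr (Sum.inr ()))
    have hl : l () = 0 := by linarith
    have hm : m () = 0 := by linarith
    rw [hl, zero_smul] at h1
    rw [hm, zero_smul] at h2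
    rw [unionA_mulVec, hrec₁ y₁ (fun j => hy (Sum.inl (Sum.inl j))) h1,
      hrec₂ y₂ (fun j => hy (Sum.inl (Sum.inr j))) h2, hl, hm]
    simp
  · apply Set.Subset.antisymm
    · -- the hull lies in the (convex) formulation, which contains `P` and `Q`
      refine convexHull_min ?_ (convex_pointedSet _ _ _ _)
      rintro x (⟨y₁, hy₁, hB₁, rfl⟩ | ⟨y₂, hy₂, hB₂, rfl⟩)
      · refine ⟨Sum.elim (Sum.elim y₁ 0) (Sum.elim (fun _ => 1) (fun _ => 0)), ?_, ?_, ?_⟩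
        · rintro ((j | j) | (u | u))
          · exact hy₁ j
          · simp
          · simp
          · simp
        · rw [unionB_mulVec_eq_iff, hB₁, mulVec_zero]
          simp
        · rw [unionA_mulVec, mulVec_zero]
          simp [add_comm]
      · refine ⟨Sum.elim (Sum.elim 0 y₂) (Sum.elim (fun _ => 0) (fun _ => 1)), ?_, ?_, ?_⟩
        · rintro ((j | j) | (u | u))
          · simp
          · exact hy₂ j
          · simp
          · simp
        · rw [unionB_mulVec_eq_iff, hB₂, mulVec_zero]
          simp
        · rw [unionA_mulVec, mulVec_zero]
          simp [add_comm]
    · -- every point of the formulation is in the hull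
      rintro x ⟨y, hy, hB, rfl⟩
      obtain ⟨y₁, y₂, l, m, rfl⟩ := exists_eq_sumElim_sumElim y
      rw [unionB_mulVec_eq_iff] at hB
      obtain ⟨h1, h2, h3⟩ := hB
      have hl0 : 0 ≤ l () := hy (Sum.inr (Sum.inl ()))
      have hm0 : 0 ≤ m () := hy (Sum.inr (Sum.inr ()))
      have hy₁ : ∀ j, 0 ≤ y₁ j := fun j => hy (Sum.inl (Sum.inl j))
      have hy₂ : ∀ j, 0 ≤ y₂ j := fun j => hy (Sum.inl (Sum.inr j))
      rw [unionA_mulVec, zero_add]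
      by_cases hl : l () = 0
      · have hm1 : m () = 1 := by linarith
        rw [hl, zero_smul] at h1
        rw [hm1, one_smul] at h2
        refine subset_convexHull ℝ _ (Or.inr ⟨y₂, hy₂, h2, ?_⟩)
        rw [hrec₁ y₁ hy₁ h1, hl, hm1, zero_add, zero_smul, zero_add, one_smul, add_comm]
      by_cases hm : m () = 0
      · have hl1 : l () = 1 := by linarith
        rw [hm, zero_smul] at h2
        rw [hl1, one_smul] at h1
        refine subset_convexHull ℝ _ (Or.inl ⟨y₁, hy₁, h1, ?_⟩)
        rw [hrec₂ y₂ hy₂ h2, hm, hl1, add_zero, one_smul, zero_smul, add_zero, add_comm]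
      have hp : c₁ + A₁ *ᵥ ((l ())⁻¹ • y₁) ∈ pointedSet c₁ A₁ B₁ b₁ :=
        ⟨_, fun j => by
          simp only [Pi.smul_apply, smul_eq_mul]
          exact mul_nonneg (inv_nonneg.2 hl0) (hy₁ j),
          by rw [mulVec_smul, h1, smul_smul, inv_mul_cancel₀ hl, one_smul], rfl⟩
      have hq : c₂ + A₂ *ᵥ ((m ())⁻¹ • y₂) ∈ pointedSet c₂ A₂ B₂ b₂ :=
        ⟨_, fun j => by
          simp only [Pi.smul_apply, smul_eq_mul]
          exact mul_nonneg (inv_nonneg.2 hm0) (hy₂ j),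
          by rw [mulVec_smul, h2, smul_smul, inv_mul_cancel₀ hm, one_smul], rfl⟩
      have hx : A₁ *ᵥ y₁ + A₂ *ᵥ y₂ + (l () • c₁ + m () • c₂) =
          l () • (c₁ + A₁ *ᵥ ((l ())⁻¹ • y₁)) + m () • (c₂ + A₂ *ᵥ ((m ())⁻¹ • y₂)) := by
        rw [mulVec_smul, mulVec_smul, smul_add, smul_add, smul_smul, smul_smul, mul_inv_cancel₀ hl,
          mul_inv_cancel₀ hm, one_smul, one_smul]
        abel
      rw [hx]
      exact convex_convexHull ℝ (pointedSet c₁ A₁ B₁ b₁ ∪ pointedSet c₂ A₂ B₂ b₂)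
        (subset_convexHull ℝ _ (Set.mem_union_left _ hp)) (subset_convexHull ℝ _ (Set.mem_union_right _ hq))
        hl0 hm0 h3

/-- Corollary in slack form: `xc(P ⊔ Q) ≤ r₁ + r₂ + 2` for pointedly represented `P, Q`.
[cite: HrubesYehudayoff2021, Lemma 34] -/
theorem HasPointedEFOfSize.hasEFOfSize_convexHull_union [Fintype ι] {P Q : Set (ι → ℝ)} {r₁ r₂ : ℕ}
    (hP : HasPointedEFOfSize P r₁) (hQ : HasPointedEFOfSize Q r₂) :
    HasEFOfSize (convexHull ℝ (P ∪ Q)) (r₁ + r₂ + 2) :=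
  (hP.convexHull_union hQ).hasEFOfSize

/-! ## General slack-form EFs: products and Minkowski sums (appended)

HY21 Lemma 34, first half, WITHOUT the pointedness restriction: for ARBITRARY slack-form extended
formulations `xc(P + Q) ≤ xc(P) + xc(Q)`.  The free natural variables of the two summands are
eliminated by the tree's linear-image theorem (`HasEFOfSize.image_linearMap`,
`ExtendedFormulationLinearImage.lean`): `P + Q` is the image of the product `P × Q ⊆ ℝ^{ι ⊕ ι}` under
`(x₁, x₂) ↦ x₁ + x₂`, and the product of two slack-form systems is the block-diagonal slack-form system
(`HasEFOfSize.prod`).  This is the bound "the extension complexity of the Minkowski sum of two polytopes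
is at most the sum of the extension complexities" used e.g. by [Fawzi2021] §3 (reduction to `A = I/n`).
-/

/-- **Products of slack-form EFs**: if `P ⊆ ℝ^ι` and `Q ⊆ ℝ^κ` have slack-form extended formulations of
sizes `r₁, r₂`, the product `{w ∈ ℝ^{ι ⊕ κ} | w|_ι ∈ P, w|_κ ∈ Q}` has one of size `r₁ + r₂` (the
block-diagonal system). [cite: HrubesYehudayoff2021, Lemma 34] -/
theorem HasEFOfSize.prod [Fintype ι] {κ : Type} [Fintype κ] {P : Set (ι → ℝ)} {Q : Set (κ → ℝ)}
    {r₁ r₂ : ℕ} (hP : HasEFOfSize P r₁) (hQ : HasEFOfSize Q r₂) :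
    HasEFOfSize {w : ι ⊕ κ → ℝ | (fun i => w (Sum.inl i)) ∈ P ∧ (fun k => w (Sum.inr k)) ∈ Q} (r₁ + r₂) := by
  obtain ⟨Q₁, hQ₁⟩ := hP
  obtain ⟨Q₂, hQ₂⟩ := hQ
  have hmem₁ : ∀ x : ι → ℝ, x ∈ P ↔ ∃ y : Fin r₁ → ℝ, (∀ j, 0 ≤ y j) ∧ Q₁.E *ᵥ x + Q₁.F *ᵥ y = Q₁.g := by
    intro x; rw [← hQ₁]; rfl
  have hmem₂ : ∀ x : κ → ℝ, x ∈ Q ↔ ∃ y : Fin r₂ → ℝ, (∀ j, 0 ≤ y j) ∧ Q₂.E *ᵥ x + Q₂.F *ᵥ y = Q₂.g := by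
    intro x; rw [← hQ₂]; rfl
  -- the block-diagonal system on `ι ⊕ κ` with slack variables `Fin r₁ ⊕ Fin r₂`
  let E' : Matrix (Fin Q₁.k ⊕ Fin Q₂.k) (ι ⊕ κ) ℝ := fromBlocks Q₁.E 0 0 Q₂.E
  let F' : Matrix (Fin Q₁.k ⊕ Fin Q₂.k) (Fin r₁ ⊕ Fin r₂) ℝ := fromBlocks Q₁.F 0 0 Q₂.F
  let g' : Fin Q₁.k ⊕ Fin Q₂.k → ℝ := Sum.elim Q₁.g Q₂.g
  have h := hasEFOfSize_of_system (ι := ι ⊕ κ) E' F' g'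
  rw [Fintype.card_sum, Fintype.card_fin, Fintype.card_fin] at h
  have hE' : ∀ w : ι ⊕ κ → ℝ, E' *ᵥ w = Sum.elim (Q₁.E *ᵥ fun i => w (Sum.inl i)) (Q₂.E *ᵥ fun k => w (Sum.inr k)) := by
    intro w
    simp only [E', fromBlocks_mulVec, zero_mulVec, add_zero, zero_add]
    rfl
  have hF' : ∀ y : Fin r₁ ⊕ Fin r₂ → ℝ, F' *ᵥ y = Sum.elim (Q₁.F *ᵥ (y ∘ Sum.inl)) (Q₂.F *ᵥ (y ∘ Sum.inr)) := by
    intro y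
    simp only [F', fromBlocks_mulVec, zero_mulVec, add_zero, zero_add]
  have hset : {w : ι ⊕ κ → ℝ | (fun i => w (Sum.inl i)) ∈ P ∧ (fun k => w (Sum.inr k)) ∈ Q} =
      {x | ∃ y : Fin r₁ ⊕ Fin r₂ → ℝ, (∀ j, 0 ≤ y j) ∧ E' *ᵥ x + F' *ᵥ y = g'} := by
    ext w
    simp only [Set.mem_setOf_eq]
    rw [hmem₁, hmem₂]
    constructor
    · rintro ⟨⟨y₁, hy₁, h₁⟩, ⟨y₂, hy₂, h₂⟩⟩
      refine ⟨Sum.elim y₁ y₂, ?_, ?_⟩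
      · rintro (j | j)
        · exact hy₁ j
        · exact hy₂ j
      · rw [hE', hF', Sum.elim_comp_inl, Sum.elim_comp_inr, sumElim_add_sumElim_eq_sumElim_iff]
        exact ⟨h₁, h₂⟩
    · rintro ⟨y, hy, hsys⟩
      rw [hE', hF', sumElim_add_sumElim_eq_sumElim_iff] at hsys
      exact ⟨⟨y ∘ Sum.inl, fun j => hy _, hsys.1⟩, ⟨y ∘ Sum.inr, fun j => hy _, hsys.2⟩⟩
  rw [hset]
  exact h

/-- **HY21 Lemma 34, first half, for arbitrary slack-form EFs: `xc(P + Q) ≤ xc(P) + xc(Q)`.**  The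
Minkowski sum is the image of the product under the linear map `(x₁, x₂) ↦ x₁ + x₂`, and linear images
keep the size of a slack-form EF. [cite: HrubesYehudayoff2021, Lemma 34] -/
theorem HasEFOfSize.add [Fintype ι] {P Q : Set (ι → ℝ)} {r₁ r₂ : ℕ} (hP : HasEFOfSize P r₁)
    (hQ : HasEFOfSize Q r₂) : HasEFOfSize (P + Q) (r₁ + r₂) := by
  let L : (ι ⊕ ι → ℝ) →ₗ[ℝ] (ι → ℝ) := LinearMap.funLeft ℝ ℝ Sum.inl + LinearMap.funLeft ℝ ℝ Sum.inr
  have hL : ∀ w : ι ⊕ ι → ℝ, L w = (fun i => w (Sum.inl i)) + fun i => w (Sum.inr i) := by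
    intro w; funext i; simp [L, LinearMap.funLeft_apply]
  have himg := (hP.prod hQ).image_linearMap L
  convert himg using 1
  ext z
  simp only [Set.mem_image, Set.mem_setOf_eq]
  constructor
  · intro hz
    obtain ⟨p, hp, q, hq, rfl⟩ := Set.mem_add.1 hz
    refine ⟨Sum.elim p q, ⟨?_, ?_⟩, ?_⟩
    · simpa using hp
    · simpa using hq
    · rw [hL]; rfl
  · rintro ⟨w, ⟨hw₁, hw₂⟩, rfl⟩
    rw [hL]
    exact Set.add_mem_add hw₁ hw₂

/-- Finite Minkowski sums: `xc(∑_{i ∈ s} P_i) ≤ ∑_{i ∈ s} xc(P_i)` for arbitrary slack-form EFs (the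
empty sum `{0}` has size `0`). [cite: HrubesYehudayoff2021, Lemma 34] -/
theorem HasEFOfSize.finsetSum [Fintype ι] {α : Type*} (s : Finset α) (P : α → Set (ι → ℝ)) (r : α → ℕ)
    (h : ∀ a ∈ s, HasEFOfSize (P a) (r a)) : HasEFOfSize (∑ a ∈ s, P a) (∑ a ∈ s, r a) := by
  classical
  induction s using Finset.induction_on with
  | empty =>
    simp only [Finset.sum_empty]
    exact (hasPointedEFOfSize_singleton (0 : ι → ℝ)).hasEFOfSize
  | insert a s ha ih =>
    rw [Finset.sum_insert ha, Finset.sum_insert ha]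
    exact (h a (Finset.mem_insert_self a s)).add (ih fun b hb => h b (Finset.mem_insert_of_mem hb))

/-! ### The bridge: every slack-form EF of a bounded set is pointed; HY21 Lemma 34 for all polytopes
(appended 2026-08-29)

The module docstring's caveat ("the bridge from an arbitrary slack-form EF of a bounded set to a pointed one
(elimination of the natural variables) is not needed for that and is not formalised here") is now
discharged: if `P = {x | ∃ y ≥ 0, E x + F y = g}` is BOUNDED and nonempty, then `E` is injective (a kernel
vector would be a line in `P`), so with any linear left inverse `L` of `E` one has `x = L g − L F y` on `P`,
`P = {L g − L F y | y ≥ 0, (F − E L F) y = g − E L g}`, and the recession condition holds because a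
direction `y ≥ 0` with `F y = E (L F y)` moves `x` along `−L F y` inside `P` (bounded ⇒ `L F y = 0`).
Hence `xc(P ⊔ Q) ≤ xc(P) + xc(Q) + 2` for ALL polytopes in the slack-form currency `HasEFOfSize`
(`HasEFOfSize.convexHull_union`), completing Lemma 34. -/

/-- A bounded set contains no ray: if `x₀ + t v ∈ P` for all `t ≥ 0` then `v = 0`. [folklore] -/
private theorem eq_zero_of_ray_subset [Fintype ι] {P : Set (ι → ℝ)} (hP : Bornology.IsBounded P)
    {x₀ v : ι → ℝ} (h : ∀ t : ℝ, 0 ≤ t → x₀ + t • v ∈ P) : v = 0 := by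
  obtain ⟨C, hC⟩ := isBounded_iff_forall_norm_le.1 hP
  by_contra hv
  have hvpos : 0 < ‖v‖ := norm_pos_iff.2 hv
  have hC0 : 0 ≤ C := le_trans (norm_nonneg _) (hC _ (by simpa using h 0 le_rfl))
  set t : ℝ := (C + ‖x₀‖ + 1) / ‖v‖ with ht
  have ht0 : 0 ≤ t := div_nonneg (by positivity) hvpos.le
  have hmem := hC _ (h t ht0)
  have htv : ‖t • v‖ = C + ‖x₀‖ + 1 := by
    rw [norm_smul, Real.norm_of_nonneg ht0, ht, div_mul_cancel₀ _ hvpos.ne']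
  have hle : ‖t • v‖ ≤ ‖x₀ + t • v‖ + ‖x₀‖ := by
    calc ‖t • v‖ = ‖(x₀ + t • v) - x₀‖ := by rw [add_sub_cancel_left]
      _ ≤ ‖x₀ + t • v‖ + ‖x₀‖ := norm_sub_le _ _
  linarith

/-- The empty set has a pointed formulation of every size (an infeasible equation `0 · y = 1`). [folklore] -/
private theorem hasPointedEFOfSize_empty_of (r : ℕ) : HasPointedEFOfSize (∅ : Set (ι → ℝ)) r := by
  refine ⟨Fin r, Fin 1, inferInstance, inferInstance, 0, 0, 0, 1, by simp, fun y _ _ => by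
    rw [zero_mulVec], ?_⟩
  ext x
  simp only [pointedSet, Set.mem_empty_iff_false, Set.mem_setOf_eq, false_iff]
  rintro ⟨y, -, hB, -⟩
  have h := congrFun hB 0
  rw [zero_mulVec, Pi.zero_apply, Pi.one_apply] at h
  exact zero_ne_one h

/-- **The bridge: a slack-form EF of size `r` of a BOUNDED set `P` is a pointed formulation of size `r`**
(elimination of the natural variables: on a bounded nonempty `P = {x | ∃ y ≥ 0, E x + F y = g}` the
matrix `E` is injective, `x = L(g − F y)` for a left inverse `L`, and the recession condition
`y ≥ 0 ∧ (F − E L F) y = 0 ⇒ L F y = 0` is boundedness of `P` again).  With this, every bound of this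
file stated for `HasPointedEFOfSize` holds for `HasEFOfSize` on polytopes.
[cite: HrubesYehudayoff2021, Lemma 34] -/
theorem HasEFOfSize.hasPointedEFOfSize [Fintype ι] {P : Set (ι → ℝ)} {r : ℕ}
    (hP : Bornology.IsBounded P) (h : HasEFOfSize P r) : HasPointedEFOfSize P r := by
  classical
  obtain ⟨Q, hQ⟩ := h
  have hmem : ∀ x : ι → ℝ, x ∈ P ↔ ∃ y : Fin r → ℝ, (∀ j, 0 ≤ y j) ∧ Q.E *ᵥ x + Q.F *ᵥ y = Q.g := by
    intro x; rw [← hQ]; rfl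
  rcases P.eq_empty_or_nonempty with hPe | ⟨x₀, hx₀⟩
  · rw [hPe]
    exact hasPointedEFOfSize_empty_of r
  obtain ⟨y₀, hy₀, hsys₀⟩ := (hmem x₀).1 hx₀
  -- `E` is injective: a kernel vector is a direction of a line inside the bounded set `P`
  have hker : LinearMap.ker (Matrix.mulVecLin Q.E) = ⊥ := by
    rw [LinearMap.ker_eq_bot']
    intro v hv
    rw [Matrix.mulVecLin_apply] at hv
    refine eq_zero_of_ray_subset hP (x₀ := x₀) fun t _ => (hmem _).2 ⟨y₀, hy₀, ?_⟩
    rw [Matrix.mulVec_add, Matrix.mulVec_smul, hv, smul_zero, add_zero, hsys₀]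
  obtain ⟨L, hL⟩ := LinearMap.exists_leftInverse_of_injective (Matrix.mulVecLin Q.E) hker
  set Lm : Matrix ι (Fin Q.k) ℝ := LinearMap.toMatrix' L with hLm_def
  have hLm : ∀ x : ι → ℝ, Lm *ᵥ (Q.E *ᵥ x) = x := fun x => by
    have h1 := LinearMap.congr_fun hL x
    rw [LinearMap.comp_apply, Matrix.mulVecLin_apply, LinearMap.id_apply] at h1
    rw [hLm_def, LinearMap.toMatrix'_mulVec, h1]
  -- on `P`: `x = L g − L F y`
  have hsolve : ∀ (x : ι → ℝ) (y : Fin r → ℝ), Q.E *ᵥ x + Q.F *ᵥ y = Q.g →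
      x = Lm *ᵥ Q.g - Lm *ᵥ (Q.F *ᵥ y) := fun x y hsys => by
    have h1 := congrArg (fun z => Lm *ᵥ z) hsys
    simp only [Matrix.mulVec_add, hLm] at h1
    rw [← h1, add_sub_cancel_right]
  refine ⟨Fin r, Fin Q.k, inferInstance, inferInstance, Lm *ᵥ Q.g, -(Lm * Q.F),
    Q.F - Q.E * (Lm * Q.F), Q.g - Q.E *ᵥ (Lm *ᵥ Q.g), by simp, ?_, ?_⟩
  · -- recession condition
    intro y hy hBy
    rw [Matrix.sub_mulVec, sub_eq_zero, ← Matrix.mulVec_mulVec, ← Matrix.mulVec_mulVec] at hBy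
    -- hBy : F y = E (L (F y)); the direction `−L F y` keeps `x₀` inside `P`
    have hw : Lm *ᵥ (Q.F *ᵥ y) = 0 := by
      have hneg : -(Lm *ᵥ (Q.F *ᵥ y)) = 0 := by
        refine eq_zero_of_ray_subset hP (x₀ := x₀) fun t ht => (hmem _).2 ⟨y₀ + t • y, fun j => ?_, ?_⟩
        · simp only [Pi.add_apply, Pi.smul_apply, smul_eq_mul]
          exact add_nonneg (hy₀ j) (mul_nonneg ht (hy j))
        · rw [Matrix.mulVec_add, Matrix.mulVec_add, Matrix.mulVec_smul, Matrix.mulVec_smul,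
            Matrix.mulVec_neg, ← hBy, ← hsys₀, smul_neg]
          abel
      rwa [neg_eq_zero] at hneg
    rw [Matrix.neg_mulVec, ← Matrix.mulVec_mulVec, hw, neg_zero]
  · -- the set equality
    ext x
    rw [hmem x]
    simp only [pointedSet, Set.mem_setOf_eq]
    constructor
    · rintro ⟨y, hy, hsys⟩
      have hx := hsolve x y hsys
      refine ⟨y, hy, ?_, ?_⟩
      · -- `(F − E L F) y = g − E L g`, from `E x = g − F y` and `x = L g − L F y`
        rw [Matrix.sub_mulVec, ← Matrix.mulVec_mulVec, ← Matrix.mulVec_mulVec]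
        have hEx : Q.E *ᵥ x = Q.E *ᵥ (Lm *ᵥ Q.g) - Q.E *ᵥ (Lm *ᵥ (Q.F *ᵥ y)) := by
          rw [hx, Matrix.mulVec_sub]
        rw [← sub_eq_zero]
        have h0 : Q.E *ᵥ x + Q.F *ᵥ y - Q.g = 0 := by rw [hsys, sub_self]
        rw [hEx] at h0
        rw [← h0]
        abel
      · rw [hx, Matrix.neg_mulVec, ← Matrix.mulVec_mulVec, sub_eq_add_neg]
    · rintro ⟨y, hy, hBy, hx⟩
      refine ⟨y, hy, ?_⟩
      rw [Matrix.sub_mulVec, ← Matrix.mulVec_mulVec, ← Matrix.mulVec_mulVec] at hBy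
      rw [hx, Matrix.neg_mulVec, ← Matrix.mulVec_mulVec, Matrix.mulVec_add, Matrix.mulVec_neg]
      -- goal: E L g + -(E L F y) + F y = g, from hBy : F y − E L F y = g − E L g
      rw [← sub_eq_zero]
      have h0 : Q.F *ᵥ y - Q.E *ᵥ (Lm *ᵥ (Q.F *ᵥ y)) - (Q.g - Q.E *ᵥ (Lm *ᵥ Q.g)) = 0 := by
        rw [hBy, sub_self]
      rw [← h0]
      abel

/-- **HY21 Lemma 34, second half, for arbitrary slack-form EFs of polytopes:
`xc(P ⊔ Q) ≤ xc(P) + xc(Q) + 2`** (Balas' formulation of the convex hull of a union), for bounded `P, Q`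
(sets with an EF are polyhedra, so bounded = polytope). [cite: HrubesYehudayoff2021, Lemma 34] -/
theorem HasEFOfSize.convexHull_union [Fintype ι] {P Q : Set (ι → ℝ)} {r₁ r₂ : ℕ}
    (hPb : Bornology.IsBounded P) (hQb : Bornology.IsBounded Q) (hP : HasEFOfSize P r₁)
    (hQ : HasEFOfSize Q r₂) : HasEFOfSize (convexHull ℝ (P ∪ Q)) (r₁ + r₂ + 2) :=
  ((hP.hasPointedEFOfSize hPb).convexHull_union (hQ.hasPointedEFOfSize hQb)).hasEFOfSize

/-- Finite unions, pointed form: `k` pieces of pointed sizes `r a` give the convex hull of their union a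
pointed formulation of size `Σ_a (r a + 2)`. [cite: HrubesYehudayoff2021, Lemma 34] -/
theorem HasPointedEFOfSize.convexHull_biUnion {α : Type*} (s : Finset α) (P : α → Set (ι → ℝ))
    (r : α → ℕ) (h : ∀ a ∈ s, HasPointedEFOfSize (P a) (r a)) :
    HasPointedEFOfSize (convexHull ℝ (⋃ a ∈ s, P a)) (∑ a ∈ s, (r a + 2)) := by
  classical
  induction s using Finset.induction_on with
  | empty => simpa using (hasPointedEFOfSize_empty_of (ι := ι) 0)
  | insert a s ha ih =>
    have h1 := h a (Finset.mem_insert_self _ _)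
    have h2 := ih fun b hb => h b (Finset.mem_insert_of_mem hb)
    have h3 := h1.convexHull_union h2
    rw [convexHull_convexHull_union_right] at h3
    rw [Finset.set_biUnion_insert, Finset.sum_insert ha]
    convert h3 using 1
    ring

/-- **Finite unions of polytopes: `xc(⊔_{a ∈ s} P_a) ≤ Σ_{a ∈ s} (xc(P_a) + 2)`** in the slack-form
currency, for bounded pieces. [cite: HrubesYehudayoff2021, Lemma 34] -/
theorem HasEFOfSize.convexHull_biUnion [Fintype ι] {α : Type*} (s : Finset α) (P : α → Set (ι → ℝ))
    (r : α → ℕ) (hb : ∀ a ∈ s, Bornology.IsBounded (P a)) (h : ∀ a ∈ s, HasEFOfSize (P a) (r a)) :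
    HasEFOfSize (convexHull ℝ (⋃ a ∈ s, P a)) (∑ a ∈ s, (r a + 2)) :=
  (HasPointedEFOfSize.convexHull_biUnion s P r fun a ha =>
    (h a ha).hasPointedEFOfSize (hb a ha)).hasEFOfSize

end Literature.Barriers.PneNP

end
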